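import Literature.AnabelianGeometry.SemiGraphs.SubdivisionLemmas
import Mathlib.Combinatorics.SimpleGraph.Connectivity.Connected
import Mathlib.CategoryTheory.Endomorphism

/-!
# Semi-graphs: morphisms over a base do not switch branches; edges of connected semi-graphs abut
# ([SemiAnbd] §1 p. 11, §3 p. 41)

Mochizuki, *Semi-graphs of Anabelioids*, Publ. RIMS **42** (2006) 221–322
[cite: MochizukiSemiAnbd2006, Thm. 3.7(iii) p.41].  Two elementary inputs of the proof of
Theorem 3.7 (iii) (p. 41: "Since the action of `H` is over `𝒢`, it follows that if `H` fixes an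
edge, then it does not switch the branches of the edge.  Since `𝒢`, hence also `𝒢_{∞,i}`, is
connected and has at least one vertex, it thus follows that every edge of `𝒢_{∞,i}` abuts to at
least one vertex."), as statements about semi-graphs (proof-only, no definitions):

* `branchMap_eq_of_over` — an endomorphism `σ` of `G` over a base (`σ ≫ p = p`) that fixes the edge
  of a branch fixes the branch (the two branches of an edge have distinct images under `p`);
* `exists_abuts_of_isConnected` — in a connected semi-graph having a vertex, every edge has a
  branch abutting to some vertex (a path of the barycentric subdivision from the edge to a vertex
  leaves the edge through a branch and can only continue through that branch's vertex).

These discharge the hypotheses `hnoswap` / `habut` of `TreeSystemFixedPoint.lean` for actions over a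
base semi-graph.
-/

namespace Literature.AnabelianGeometry.SemiGraphs

namespace SemiGraph

open CategoryTheory

universe u

/-- An endomorphism over a base does not switch branches: if `σ ≫ p = p` and `σ` fixes the edge of
the branch `b`, then `σ` fixes `b` — `σ b` and `b` are branches of one edge with the same image under
`p`, and `p` is injective on the branches of an edge. [cite: MochizukiSemiAnbd2006, Thm. 3.7(iii) p.41] -/
theorem branchMap_eq_of_over {G H : SemiGraph.{u}} (p : G ⟶ H) (σ : G ⟶ G) (hσ : σ ≫ p = p)
    (b : G.Branch) (he : σ.edgeMap (G.edgeOf b) = G.edgeOf b) : σ.branchMap b = b := by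
  apply p.branchMap_injOn
  · rw [σ.edgeOf_branchMap, he]
  · have h := congrArg Hom.branchMap hσ
    exact congrFun h b

/-- An automorphism over a base does not switch branches (the case of `Aut G` used for group
actions over `𝒢`). [cite: MochizukiSemiAnbd2006, Thm. 3.7(iii) p.41] -/
theorem branchMap_eq_of_over_aut {G H : SemiGraph.{u}} (p : G ⟶ H) (σ : Aut G) (hσ : σ.hom ≫ p = p)
    (b : G.Branch) (he : σ.hom.edgeMap (G.edgeOf b) = G.edgeOf b) : σ.hom.branchMap b = b :=
  branchMap_eq_of_over p σ.hom hσ b he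

/-- In a connected semi-graph with at least one vertex, every edge has a branch abutting to some
vertex. [cite: MochizukiSemiAnbd2006, Thm. 3.7(iii) p.41] -/
theorem exists_abuts_of_isConnected {G : SemiGraph.{u}} (hG : G.IsConnected) (v₀ : G.Vertex)
    (e : G.Edge) : ∃ b : G.Branch, G.edgeOf b = e ∧ (G.abuts b).isSome := by
  classical
  obtain ⟨p, hp⟩ := hG.connected.exists_isPath (Sum.inr (Sum.inl e)) (Sum.inl v₀)
  have hinj : ∀ i j : ℕ, i ≤ p.length → j ≤ p.length → p.getVert i = p.getVert j → i = j :=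
    fun i j hi hj h => hp.getVert_injOn hi hj h
  -- the path has length ≥ 2: its end is a vertex, not adjacent to the edge-node
  have hl0 : p.length ≠ 0 := fun h => by
    have := p.eq_of_length_eq_zero h
    simp at this
  have h01 := p.adj_getVert_succ (i := 0) (by omega)
  rw [p.getVert_zero] at h01
  obtain ⟨b, hbe, h1⟩ := (G.subdivision_adj_edge_iff e _).mp h01
  have hl1 : p.length ≠ 1 := fun h => by
    have h2 : p.getVert 1 = Sum.inl v₀ := h ▸ p.getVert_length
    rw [h1] at h2
    simp at h2
  -- the node after the branch `b` is not the edge again, hence is the vertex of `b`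
  have h12 := p.adj_getVert_succ (i := 1) (by omega)
  rw [h1] at h12
  rcases (G.subdivision_adj_branch_iff b _).mp h12 with h2 | ⟨v, hv, -⟩
  · exfalso
    have : (2 : ℕ) = 0 := hinj 2 0 (by omega) (by omega) (by rw [h2, p.getVert_zero, hbe])
    omega
  · exact ⟨b, hbe, by rw [hv]; rfl⟩

end SemiGraph

end Literature.AnabelianGeometry.SemiGraphs
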